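import Summits.FinalStateConjecture.FinalStateConjecture.Theorems.ClusterCompletenessOmegaLimitMultiKerrBarbalat
import Literature.Geometry.Lorentzian.BondiSachsRadiativeEnd
import Mathlib.MeasureTheory.Integral.IntervalIntegral.FundThmCalculus
import HarnessLib

/-!
# Route ClusterCompleteness · crux `OmegaLimitMultiKerr` — the scri budget: the transfer identity
# at null infinity, the window tails of the news flux, Barbalat

Structure lemmas for the crux stmt-FinalStateConjecture-14664
(`ClusterCompleteness.OmegaLimitMultiKerr`, rank 9), line `Sketch`, lead gen 5, registered stub
`bondiMass_sub_eq_integral_newsFlux` (closed form). Companion of `…Barbalat` and of the transfer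
form of the invariance principle (`flux_omegaLimit_translate_eq_zero_of_transfer`).

The LaSalle reading of the crux needs a FAR-AWAY monotone quantity `M(t)` (a function of time only)
and a TRANSFER inequality `∫_{[t, t + L]} Φ_K ≤ C · (M(t − c) − M(t + L + c)) + err(t)` bounding a
local chart flux by its decrements; `M → M_f` and `err → 0` then kill the flux on ω-limits. This
file certifies the SCRI side of that input from the tree's hypothesis structure
`BondiSachsRadiativeEnd 𝒟` (Bondi mass aspect, news, mass-loss law, finite total news flux —
Christodoulou–Klainerman 1993, Ch. 17, conclusions 17.0.8–17.0.9; Wald 1984, (11.2.13)):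

* `hasDerivAt_bondiMass_newsFlux` — the mass-loss law with the news FLUX `F(u) = ∮ |N(u, ·)|² dμ`:
  `dM_B/du = −(4π)⁻¹ F(u)` (`⨍ dμ = (4π)⁻¹ ∮ dμ` since `μ(S²) = 4π`).
* `bondiMass_sub_eq_integral_newsFlux` (the registered stub) — **the transfer identity at null
  infinity**: `M_B(u₁) − M_B(u₂) = (4π)⁻¹ ∫_{[u₁, u₂]} F` for `u₀ ≤ u₁ ≤ u₂` (FTC-2 for the
  integrable derivative `−(4π)⁻¹ F`); flux forms `setIntegral_newsFlux_Icc_eq`,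
  `setIntegral_newsFlux_Icc_add_le` (the transfer inequality in the exact shape consumed by the
  transfer form: `Φ = F`, `C = 4π`, `err = 0`, any lag `c ≥ 0`).
* `tendsto_setIntegral_newsFlux_Icc_add` — **no news is radiated in any late window**:
  `∫_{[u, u + L]} F → 0` as `u → +∞` (window tails of the integrable flux); hence
  `tendsto_bondiMass_sub_bondiMass_add` — the Bondi-mass decrements over windows of fixed length die
  out, with NO positivity / convergence assumption on `M_B`.
* `tendsto_bondiMass_sub_bondiMass` — if `M_B → m` then `M_B(t − c) − M_B(t + L + c) → 0` (the
  `M`-decrement of the transfer inequality dies out).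
* `tendsto_newsFlux_of_uniformContinuousOn` — **Barbalat at scri**: a news flux uniformly continuous
  on `[u₀, ∞)` (tame news) tends to `0` — the end becomes non-radiative.

Everything is proved; Mathlib + the landed files only; no definitions.
-/

-- every `Summit.FinalStateConjecture.FinalStateConjecture.…` name repeats the summit = sub-problem segment (D-0017 layout)
set_option linter.dupNamespace false

noncomputable section

open Set Filter Topology Function
open scoped Manifold Real ContDiff Topology ENNReal

namespace Summit.FinalStateConjecture.FinalStateConjecture.Theorems.ClusterCompleteness

open Literature.Geometry.Lorentzian MeasureTheory

variable {X : Type*} [TopologicalSpace X] [ChartedSpace (EuclideanSpace ℝ (Fin 3)) X]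
  [IsManifold (𝓡 3) ∞ X] [ConnectedSpace X] {D : InitialDataSet (𝓡 3) X}
  {𝒟 : CauchyDevelopment D}

/-! ### The mass-loss law with the news flux -/

/-- The reference sphere measure of a Bondi–Sachs radiative end has real total mass `4π` (the area
of the unit round sphere; field `measure_univ`). [folklore] -/
theorem measureReal_univ_bondiSachs (𝓔 : BondiSachsRadiativeEnd 𝒟) : 𝓔.μ.real univ = 4 * π := by
  rw [measureReal_def, 𝓔.measure_univ, ENNReal.toReal_ofReal (by positivity)]

/-- Sphere averages against the reference measure are `(4π)⁻¹` times sphere integrals: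
`⨍ |N(u, ·)|² dμ = (4π)⁻¹ F(u)`. [folklore] -/
theorem average_news_sq_eq (𝓔 : BondiSachsRadiativeEnd 𝒟) (u : ℝ) :
    ⨍ y, ‖𝓔.news u y‖ ^ 2 ∂𝓔.μ = (4 * π)⁻¹ * 𝓔.newsFlux u := by
  rw [average_eq, measureReal_univ_bondiSachs, smul_eq_mul]
  rfl

/-- **Bondi mass loss with the news flux** (BvdBM §5; CK 17.0.8; Wald (11.2.13)): for `u ≥ u₀`,
`dM_B/du = −(4π)⁻¹ F(u)` where `F(u) = ∮ |N(u, ·)|² dμ` is the news flux.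
[cite: Wald1984, §11.2 (11.2.13)] -/
theorem hasDerivAt_bondiMass_newsFlux (𝓔 : BondiSachsRadiativeEnd 𝒟) {u : ℝ} (hu : 𝓔.u₀ ≤ u) :
    HasDerivAt 𝓔.bondiMass (-((4 * π)⁻¹ * 𝓔.newsFlux u)) u := by
  rw [← average_news_sq_eq]
  exact BondiSachsRadiativeEnd.hasDerivAt_bondiMass hu

/-- The news flux is integrable on every retarded window `[u₁, u₂]` with `u₀ ≤ u₁` (finite total
news flux, CK 17.0.9). [cite: ChristodoulouKlainerman1993, Ch. 17, conclusion 17.0.9] -/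
theorem newsFlux_integrableOn_Icc (𝓔 : BondiSachsRadiativeEnd 𝒟) {u₁ : ℝ} (u₂ : ℝ)
    (h₁ : 𝓔.u₀ ≤ u₁) : IntegrableOn 𝓔.newsFlux (Icc u₁ u₂) :=
  𝓔.newsFlux_integrableOn.mono_set fun _ hu ↦ h₁.trans hu.1

/-! ### The transfer identity at null infinity -/

/-- **Registered structure stub (crux stmt-FinalStateConjecture-14664, line `Sketch`): the
transfer identity at null infinity.** For a Bondi–Sachs radiative end and retarded times
`u₀ ≤ u₁ ≤ u₂`, the Bondi mass radiated through the portion `u₁ ≤ u ≤ u₂` of future null infinity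
is `(4π)⁻¹` times the integrated news flux:
`M_B(u₁) − M_B(u₂) = (4π)⁻¹ ∫_{[u₁, u₂]} F(u) du`, `F(u) = ∮ |N(u, ·)|² dμ` — the integrated
Bondi mass-loss formula (BvdBM §5; CK 17.0.8; Wald (11.2.13)), by the fundamental theorem of
calculus for `M_B`, whose derivative `−(4π)⁻¹ F` is integrable on `[u₀, ∞)` (CK 17.0.9). Closed
form. [cite: ChristodoulouKlainerman1993, Ch. 17, conclusion 17.0.8] -/
theorem bondiMass_sub_eq_integral_newsFlux :
    ∀ {X : Type*} [TopologicalSpace X] [ChartedSpace (EuclideanSpace ℝ (Fin 3)) X]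
      [IsManifold (𝓡 3) ∞ X] [ConnectedSpace X] {D : InitialDataSet (𝓡 3) X}
      {𝒟 : CauchyDevelopment D} (𝓔 : BondiSachsRadiativeEnd 𝒟) {u₁ u₂ : ℝ},
      𝓔.u₀ ≤ u₁ → u₁ ≤ u₂ →
      𝓔.bondiMass u₁ - 𝓔.bondiMass u₂ = (4 * π)⁻¹ * ∫ u in Icc u₁ u₂, 𝓔.newsFlux u := by
  intro X _ _ _ _ D 𝒟 𝓔 u₁ u₂ h₁ h₁₂
  -- `M_B' = -(4π)⁻¹ F` on `[u₁, u₂]`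
  have hderiv : ∀ u ∈ uIcc u₁ u₂, HasDerivAt 𝓔.bondiMass (-((4 * π)⁻¹ * 𝓔.newsFlux u)) u := by
    intro u hu
    rw [uIcc_of_le h₁₂] at hu
    exact hasDerivAt_bondiMass_newsFlux 𝓔 (h₁.trans hu.1)
  -- the derivative is integrable on `[u₁, u₂]`
  have hint : IntervalIntegrable (fun u ↦ -((4 * π)⁻¹ * 𝓔.newsFlux u)) volume u₁ u₂ := by
    have h : IntegrableOn 𝓔.newsFlux (uIcc u₁ u₂) := by
      rw [uIcc_of_le h₁₂]
      exact newsFlux_integrableOn_Icc 𝓔 u₂ h₁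
    exact (h.intervalIntegrable.const_mul _).neg
  -- FTC-2
  have hftc := intervalIntegral.integral_eq_sub_of_hasDerivAt hderiv hint
  rw [intervalIntegral.integral_neg, intervalIntegral.integral_const_mul,
    intervalIntegral.integral_of_le h₁₂, ← integral_Icc_eq_integral_Ioc] at hftc
  linarith

/-- The transfer identity, flux form: `∫_{[u₁, u₂]} F = 4π (M_B(u₁) − M_B(u₂))` for
`u₀ ≤ u₁ ≤ u₂`. [cite: ChristodoulouKlainerman1993, Ch. 17, conclusion 17.0.8] -/
theorem setIntegral_newsFlux_Icc_eq (𝓔 : BondiSachsRadiativeEnd 𝒟) {u₁ u₂ : ℝ} (h₁ : 𝓔.u₀ ≤ u₁)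
    (h₁₂ : u₁ ≤ u₂) :
    ∫ u in Icc u₁ u₂, 𝓔.newsFlux u = 4 * π * (𝓔.bondiMass u₁ - 𝓔.bondiMass u₂) := by
  rw [bondiMass_sub_eq_integral_newsFlux 𝓔 h₁ h₁₂, ← mul_assoc, mul_inv_cancel₀ (by positivity),
    one_mul]

/-- **The transfer inequality at null infinity** (the shape consumed by the transfer form of the
invariance principle, with `Φ = F`, `C = 4π`, `err = 0` and any lag `c ≥ 0`): for `t ≥ u₀ + c`,
`∫_{[t, t + L]} F ≤ 4π (M_B(t − c) − M_B(t + L + c))`, since `M_B` is non-increasing on `[u₀, ∞)`.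
[cite: ChristodoulouKlainerman1993, Ch. 17, conclusion 17.0.8] -/
theorem setIntegral_newsFlux_Icc_add_le (𝓔 : BondiSachsRadiativeEnd 𝒟) {c L : ℝ} (hc : 0 ≤ c)
    (hL : 0 ≤ L) :
    ∀ t ∈ Ici (𝓔.u₀ + c), ∫ s in Icc t (t + L), 𝓔.newsFlux s ≤
      4 * π * (𝓔.bondiMass (t - c) - 𝓔.bondiMass (t + L + c)) := by
  intro t ht
  have ht' : 𝓔.u₀ ≤ t - c := by rw [mem_Ici] at ht; linarith
  have ht₀ : 𝓔.u₀ ≤ t := by linarith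
  rw [setIntegral_newsFlux_Icc_eq 𝓔 ht₀ (by linarith)]
  have h₁ : 𝓔.bondiMass t ≤ 𝓔.bondiMass (t - c) :=
    BondiSachsRadiativeEnd.bondiMass_antitoneOn (mem_Ici.2 ht') (mem_Ici.2 ht₀) (by linarith)
  have h₂ : 𝓔.bondiMass (t + L + c) ≤ 𝓔.bondiMass (t + L) :=
    BondiSachsRadiativeEnd.bondiMass_antitoneOn (mem_Ici.2 (by linarith)) (mem_Ici.2 (by linarith))
      (by linarith)
  have hπ : 0 < 4 * π := by positivity
  nlinarith

/-! ### Window tails of the news flux -/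

/-- **No news is radiated in any late window**: `∫_{[u, u + L]} F → 0` as `u → +∞`, for every
`L` (window tails of the integrable news flux, CK 17.0.9).
[cite: ChristodoulouKlainerman1993, Ch. 17, conclusion 17.0.9] -/
theorem tendsto_setIntegral_newsFlux_Icc_add (𝓔 : BondiSachsRadiativeEnd 𝒟) (L : ℝ) :
    Tendsto (fun u ↦ ∫ v in Icc u (u + L), 𝓔.newsFlux v) atTop (𝓝 0) :=
  tendsto_setIntegral_Icc_add_of_integrableOn 𝓔.newsFlux_integrableOn L

/-- Hence the Bondi mass radiated through late windows of fixed length `L ≥ 0` dies out: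
`M_B(t) − M_B(t + L) → 0` as `t → +∞` — with no positivity or convergence assumption on `M_B`.
[cite: ChristodoulouKlainerman1993, Ch. 17, conclusion 17.0.9] -/
theorem tendsto_bondiMass_sub_bondiMass_add (𝓔 : BondiSachsRadiativeEnd 𝒟) {L : ℝ} (hL : 0 ≤ L) :
    Tendsto (fun t ↦ 𝓔.bondiMass t - 𝓔.bondiMass (t + L)) atTop (𝓝 0) := by
  have h := (tendsto_setIntegral_newsFlux_Icc_add 𝓔 L).const_mul (4 * π)⁻¹
  rw [mul_zero] at h
  refine h.congr' ?_
  filter_upwards [eventually_ge_atTop 𝓔.u₀] with t ht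
  exact (bondiMass_sub_eq_integral_newsFlux 𝓔 ht (by linarith)).symm

/-- If the Bondi mass converges, `M_B → m`, then the `M`-decrement of the transfer inequality dies
out: `M_B(t − c) − M_B(t + L + c) → 0` as `t → +∞`, for all `c`, `L`.
[cite: ChristodoulouKlainerman1993, Ch. 17, conclusion 17.0.9] -/
theorem tendsto_bondiMass_sub_bondiMass (𝓔 : BondiSachsRadiativeEnd 𝒟) {m : ℝ}
    (h : 𝓔.HasFinalBondiMass m) (c L : ℝ) :
    Tendsto (fun t ↦ 𝓔.bondiMass (t - c) - 𝓔.bondiMass (t + L + c)) atTop (𝓝 0) := by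
  have hm : Tendsto 𝓔.bondiMass atTop (𝓝 m) := h
  have h₁ : Tendsto (fun t : ℝ ↦ t - c) atTop atTop := tendsto_atTop_add_const_right _ _ tendsto_id
  have h₂ : Tendsto (fun t : ℝ ↦ t + L + c) atTop atTop :=
    tendsto_atTop_add_const_right _ _ (tendsto_atTop_add_const_right _ _ tendsto_id)
  have key : Tendsto (fun t ↦ 𝓔.bondiMass (t - c) - 𝓔.bondiMass (t + L + c)) atTop (𝓝 (m - m)) :=
    (hm.comp h₁).sub (hm.comp h₂)
  rwa [sub_self] at key

/-! ### Barbalat at scri -/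

/-- **Tame news ⇒ the end becomes non-radiative** (Barbalat's lemma at null infinity): if the news
flux `F` is uniformly continuous on `[u₀, ∞)` then, being integrable there (CK 17.0.9), it tends
to `0` as `u → +∞`; hence so does `dM_B/du = −(4π)⁻¹ F`. [folklore] -/
theorem tendsto_newsFlux_of_uniformContinuousOn (𝓔 : BondiSachsRadiativeEnd 𝒟)
    (hu : UniformContinuousOn 𝓔.newsFlux (Ici 𝓔.u₀)) : Tendsto 𝓔.newsFlux atTop (𝓝 0) :=
  barbalat_tendsto_zero hu 𝓔.newsFlux_integrableOn

/-- Under tame news the mass-loss RATE dies out: `(4π)⁻¹ F(u) → 0`, i.e. `dM_B/du → 0` as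
`u → +∞`. [folklore] -/
theorem tendsto_deriv_bondiMass_of_uniformContinuousOn (𝓔 : BondiSachsRadiativeEnd 𝒟)
    (hu : UniformContinuousOn 𝓔.newsFlux (Ici 𝓔.u₀)) :
    Tendsto (deriv 𝓔.bondiMass) atTop (𝓝 0) := by
  have h := ((tendsto_newsFlux_of_uniformContinuousOn 𝓔 hu).const_mul (4 * π)⁻¹).neg
  rw [mul_zero, neg_zero] at h
  refine h.congr' ?_
  filter_upwards [eventually_ge_atTop 𝓔.u₀] with u huu
  exact ((hasDerivAt_bondiMass_newsFlux 𝓔 huu).deriv).symm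

end Summit.FinalStateConjecture.FinalStateConjecture.Theorems.ClusterCompleteness

end
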